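import Summits.BirchSwinnertonDyer.BirchSwinnertonDyer.Theorems.SignedLowerHalvesSmallImageLowerHalfBothSignsRttCharRoadE2OfDepletedJunction
import HarnessLib

/-!
# Route `SignedLowerHalves`, crux L `SmallImageLowerHalfBothSigns` (stmt-BirchSwinnertonDyer-23599), line `rtt_w3` v14 → v15 — E2, DEPLETED junction, row J1⁺:
# THE JUNCTION CARRIER IS FINITELY GENERATED OVER `Λ` as soon as `coker sp¹` is (no separate print needed)

WHY (LEAD `cruxlead-stmt-BirchSwinnertonDyer-23599` g11; BRIEF-E2 rev 5.2 §3 row J1⁺). The depleted consumers (p784031 …, p784278) carry the instance binder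
`[Module.Finite Λ B]` for the junction carrier `B = 𝐇¹_Iw`. This file discharges it from data the junction already has: `Hsp = H1/fH1` is finitely generated over
`Λ_𝒪` in its PINNED structure (`hιH`: `l • x = (map C l) • x`; every `r ∈ R = Λ_𝒪⟦T₁⟧` is `≡ map C (φ r)` modulo `f = C (X − C b)`, which kills `Hsp`), hence over `Λ`;
and `0 → range s → B → B ⧸ range s → 0` with `B ⧸ range s` finitely generated (row J2: `coker sp¹ ↪ H²₂[f]`) gives `B` finitely generated (`Module.Finite.of_exact`).
★ `span_eq_top_of_pinned` / ★★ `moduleFinite_quotSMulTop_of_pinned` (Hsp f.g. over `Λ_𝒪`, pinned structure), ★★ `moduleFinite_carrier_of_quotient_range` (B f.g. over `Λ`).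

THEOREMS ONLY (`--supports stmt-BirchSwinnertonDyer-23599` helper); closes nothing; crux L, crux M, E2 and BSD remain OPEN and are proved for NO curve by any of this.
[cite: JohnsonLeungKings2011, §4.1–§4.2] [cite: BourbakiAC5to7, VII §4.5] [folklore]
-/

set_option autoImplicit false
-- the Theorems namespace of this sub repeats the summit name by design (D-0017 nested layout)
set_option linter.dupNamespace false

noncomputable section
open scoped Pointwise

open PowerSeries Literature.NumberTheory.EllipticCurves Literature.NumberTheory.EllipticCurves.Module
open Literature.NumberTheory.ComplexMultiplication.EllipticUnits.JohnsonLeungKings2011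
open Summit.BirchSwinnertonDyer.BirchSwinnertonDyer.Theorems.SmallImageRttD2LamSpec

namespace Summit.BirchSwinnertonDyer.BirchSwinnertonDyer.Theorems.SmallImageRttCharRoad

universe v w

section Finite

variable {p : ℕ} [Fact p.Prime] {S : Set (PadicAlgCl p)}

/-- ★ **Every `R`-span is already a `Λ_𝒪`-span in the pinned structure on `Hsp = H1/fH1`**: for a set `T ⊆ Hsp`, `span_R T ≤ span_{Λ_𝒪} T` (as sets), because
`r • x = (φ r) • x` on `Hsp` (`r − map C (φ r) ∈ (f)` and `f • Hsp = 0`). [cite: BourbakiAC5to7, VII §4.5] [folklore] -/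
theorem span_le_span_of_pinned {H1 : Type v} [AddCommGroup H1] [Module (PowerSeries (IwasawaAlgebraO S)) H1]
    (b : padicCoeffIntegers S) (φ : PowerSeries (IwasawaAlgebraO S) →+* IwasawaAlgebraO S)
    (hC : ∀ a : padicCoeffIntegers S, φ (C (C a)) = C a) (hX : φ X = X) (hker : RingHom.ker φ = Ideal.span {C (X - C b)})
    [Module (IwasawaAlgebraO S) (QuotSMulTop (C (X - C b) : PowerSeries (IwasawaAlgebraO S)) H1)]
    (hιH : ∀ (l : IwasawaAlgebraO S) (x : QuotSMulTop (C (X - C b) : PowerSeries (IwasawaAlgebraO S)) H1),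
      l • x = (PowerSeries.map (PowerSeries.C : padicCoeffIntegers S →+* IwasawaAlgebraO S) l) • x)
    (T : Set (QuotSMulTop (C (X - C b) : PowerSeries (IwasawaAlgebraO S)) H1)) :
    (Submodule.span (PowerSeries (IwasawaAlgebraO S)) T : Set (QuotSMulTop (C (X - C b) : PowerSeries (IwasawaAlgebraO S)) H1)) ⊆
      Submodule.span (IwasawaAlgebraO S) T := by
  -- `r • x = (φ r) • x` on `Hsp`
  have hsmul : ∀ (r : PowerSeries (IwasawaAlgebraO S)) (x : QuotSMulTop (C (X - C b) : PowerSeries (IwasawaAlgebraO S)) H1),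
      r • x = (φ r) • x := fun r x ↦ by
    have hret : φ (PowerSeries.map (PowerSeries.C : padicCoeffIntegers S →+* IwasawaAlgebraO S) (φ r)) = φ r :=
      map_outer_eq_self_of_clauses' φ hC hX (φ r)
    have hmem : r - PowerSeries.map (PowerSeries.C : padicCoeffIntegers S →+* IwasawaAlgebraO S) (φ r) ∈ RingHom.ker φ := by
      rw [RingHom.mem_ker, map_sub, hret, sub_self]
    rw [hker, Ideal.mem_span_singleton] at hmem
    obtain ⟨q, hq⟩ := hmem
    obtain ⟨m, rfl⟩ := Submodule.Quotient.mk_surjective _ x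
    have hkill : (C (X - C b) : PowerSeries (IwasawaAlgebraO S)) •
        (Submodule.Quotient.mk m : QuotSMulTop (C (X - C b) : PowerSeries (IwasawaAlgebraO S)) H1) = 0 := by
      rw [← Submodule.Quotient.mk_smul, Submodule.Quotient.mk_eq_zero]
      exact Submodule.smul_mem_pointwise_smul m _ _ Submodule.mem_top
    calc r • (Submodule.Quotient.mk m : QuotSMulTop (C (X - C b) : PowerSeries (IwasawaAlgebraO S)) H1)
        = (PowerSeries.map (PowerSeries.C : padicCoeffIntegers S →+* IwasawaAlgebraO S) (φ r) + C (X - C b) * q) •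
            (Submodule.Quotient.mk m : QuotSMulTop (C (X - C b) : PowerSeries (IwasawaAlgebraO S)) H1) := by rw [← hq, add_sub_cancel]
      _ = (φ r) • (Submodule.Quotient.mk m : QuotSMulTop (C (X - C b) : PowerSeries (IwasawaAlgebraO S)) H1) := by
          rw [add_smul, mul_comm, mul_smul, hkill, smul_zero, add_zero, ← hιH]
  intro x hx
  refine Submodule.span_induction (p := fun y _ ↦ (y ∈ (Submodule.span (IwasawaAlgebraO S) T :
      Submodule (IwasawaAlgebraO S) (QuotSMulTop (C (X - C b) : PowerSeries (IwasawaAlgebraO S)) H1)))) ?_ ?_ ?_ ?_ hx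
  · exact fun y hy ↦ Submodule.subset_span hy
  · exact Submodule.zero_mem _
  · exact fun y z _ _ hy hz ↦ Submodule.add_mem _ hy hz
  · intro r y _ hy
    rw [hsmul]
    exact Submodule.smul_mem _ _ hy

/-- ★★ **`Hsp = H1/fH1` is finitely generated over `Λ_𝒪` in its pinned structure** (`H1` finitely generated over `R`). [cite: JohnsonLeungKings2011, §4.2]
[cite: BourbakiAC5to7, VII §4.5] [folklore] -/
theorem moduleFinite_quotSMulTop_of_pinned {H1 : Type v} [AddCommGroup H1] [Module (PowerSeries (IwasawaAlgebraO S)) H1]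
    [Module.Finite (PowerSeries (IwasawaAlgebraO S)) H1]
    (b : padicCoeffIntegers S) (φ : PowerSeries (IwasawaAlgebraO S) →+* IwasawaAlgebraO S)
    (hC : ∀ a : padicCoeffIntegers S, φ (C (C a)) = C a) (hX : φ X = X) (hker : RingHom.ker φ = Ideal.span {C (X - C b)})
    [Module (IwasawaAlgebraO S) (QuotSMulTop (C (X - C b) : PowerSeries (IwasawaAlgebraO S)) H1)]
    (hιH : ∀ (l : IwasawaAlgebraO S) (x : QuotSMulTop (C (X - C b) : PowerSeries (IwasawaAlgebraO S)) H1),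
      l • x = (PowerSeries.map (PowerSeries.C : padicCoeffIntegers S →+* IwasawaAlgebraO S) l) • x) :
    Module.Finite (IwasawaAlgebraO S) (QuotSMulTop (C (X - C b) : PowerSeries (IwasawaAlgebraO S)) H1) := by
  obtain ⟨T, hT⟩ := (inferInstance : Module.Finite (PowerSeries (IwasawaAlgebraO S))
    (QuotSMulTop (C (X - C b) : PowerSeries (IwasawaAlgebraO S)) H1)).fg_top
  refine ⟨⟨T, ?_⟩⟩
  refine eq_top_iff.mpr fun x _ ↦ ?_
  have hx : x ∈ ((Submodule.span (PowerSeries (IwasawaAlgebraO S)) (T : Set (QuotSMulTop (C (X - C b) : PowerSeries (IwasawaAlgebraO S)) H1)) :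
      Submodule (PowerSeries (IwasawaAlgebraO S)) (QuotSMulTop (C (X - C b) : PowerSeries (IwasawaAlgebraO S)) H1)) :
      Set (QuotSMulTop (C (X - C b) : PowerSeries (IwasawaAlgebraO S)) H1)) := by
    rw [hT]; trivial
  exact span_le_span_of_pinned b φ hC hX hker hιH (T : Set (QuotSMulTop (C (X - C b) : PowerSeries (IwasawaAlgebraO S)) H1)) hx

/-- ★★ **Row J1⁺ discharged: the junction carrier `B` is finitely generated over `Λ`** as soon as `B ⧸ range s` is (row J2) — `Hsp` is finitely generated over `Λ_𝒪`
(pinned structure), hence over `Λ` (`Λ_𝒪` finite over `Λ`), and `0 → range s → B → B ⧸ range s → 0`. The instance binder `[Module.Finite Λ B]` of the depleted consumers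
(p784031, p784139, p784182, p784278). [cite: JohnsonLeungKings2011, §4.1–§4.2] [folklore] -/
theorem moduleFinite_carrier_of_quotient_range [FiniteDimensional ℚ_[p] (padicCoeffField S)]
    {H1 : Type v} [AddCommGroup H1] [Module (PowerSeries (IwasawaAlgebraO S)) H1] [Module.Finite (PowerSeries (IwasawaAlgebraO S)) H1]
    (b : padicCoeffIntegers S) (φ : PowerSeries (IwasawaAlgebraO S) →+* IwasawaAlgebraO S)
    (hC : ∀ a : padicCoeffIntegers S, φ (C (C a)) = C a) (hX : φ X = X) (hker : RingHom.ker φ = Ideal.span {C (X - C b)})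
    [Module (IwasawaAlgebraO S) (QuotSMulTop (C (X - C b) : PowerSeries (IwasawaAlgebraO S)) H1)]
    (hιH : ∀ (l : IwasawaAlgebraO S) (x : QuotSMulTop (C (X - C b) : PowerSeries (IwasawaAlgebraO S)) H1),
      l • x = (PowerSeries.map (PowerSeries.C : padicCoeffIntegers S →+* IwasawaAlgebraO S) l) • x)
    [Algebra (IwasawaAlgebra p) (IwasawaAlgebraO S)]
    (halg : ∀ r : IwasawaAlgebra p, algebraMap (IwasawaAlgebra p) (IwasawaAlgebraO S) r = iwasawaToIwasawaO S r)
    [Module (IwasawaAlgebra p) (QuotSMulTop (C (X - C b) : PowerSeries (IwasawaAlgebraO S)) H1)]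
    [IsScalarTower (IwasawaAlgebra p) (IwasawaAlgebraO S) (QuotSMulTop (C (X - C b) : PowerSeries (IwasawaAlgebraO S)) H1)]
    {B : Type w} [AddCommGroup B] [Module (IwasawaAlgebraO S) B] [Module (IwasawaAlgebra p) B] [IsScalarTower (IwasawaAlgebra p) (IwasawaAlgebraO S) B]
    (s : QuotSMulTop (C (X - C b) : PowerSeries (IwasawaAlgebraO S)) H1 →ₗ[IwasawaAlgebraO S] B)
    [Module.Finite (IwasawaAlgebra p) (B ⧸ LinearMap.range s)] : Module.Finite (IwasawaAlgebra p) B := by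
  haveI : Module.Finite (IwasawaAlgebraO S) (QuotSMulTop (C (X - C b) : PowerSeries (IwasawaAlgebraO S)) H1) :=
    moduleFinite_quotSMulTop_of_pinned b φ hC hX hker hιH
  haveI : Module.Finite (IwasawaAlgebra p) (QuotSMulTop (C (X - C b) : PowerSeries (IwasawaAlgebraO S)) H1) :=
    moduleFinite_of_moduleFinite_iwasawaAlgebraO p S halg _
  haveI : Module.Finite (IwasawaAlgebra p) (B ⧸ LinearMap.range (s.restrictScalars (IwasawaAlgebra p))) :=
    Module.Finite.equiv ((Submodule.quotEquivOfEq _ _ (LinearMap.range_restrictScalars s)).trans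
      (Submodule.Quotient.restrictScalarsEquiv (IwasawaAlgebra p) (LinearMap.range s))).symm
  exact Module.Finite.of_exact (LinearMap.exact_map_mkQ_range (s.restrictScalars (IwasawaAlgebra p))) (Submodule.mkQ_surjective _)

end Finite

end Summit.BirchSwinnertonDyer.BirchSwinnertonDyer.Theorems.SmallImageRttCharRoad

end
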